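import Summits.QuantumFields.BalabanUV.Beta.GAN24.CapacitanceSolve

/-!
# `BalabanUV.Beta.GAN24.FibreKernelControl` — binder row G-an2-4 / (CONV-C), road P1-fibre, self-row **N15k-ker*** (journal CLAIM
# 2026-08-20T00:1xZ; the FIBRE half of the p1-designed node N15k «N- and p-uniform real-zone kernel coercivity» of `HOME/GAN24/Formal/DAG.md`
# v2.6, input of p1's L10 `FibreStrip`), PART 1: the transverse energy of a real KKT fibre and the structure of `ker B`

NOT IN PRINT; OUR PROOF ATTEMPT.  HONEST FRAMING (cell contract, verbatim): «discharging `BetaPertH` makes Bałaban's UV stability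
UNCONDITIONAL — a real constructive-QFT result; it is NOT the continuum limit and NOT the Clay problem.»  HONEST DEPENDENCY (verbatim):
«continuum YM on T⁴ ⇐ BetaPertH ∧ nine spine estimates (0/9 proved); BetaPertH ⇐ (D1) ∧ (D4) ∧ CAP+tail; G-an2-4 gates asym, D1 and
NE2/3/4.»  [folklore] finite-dimensional algebra and Cauchy–Schwarz over `ℂ` in EXACTLY the currency of `GAN24/CapacitanceSolve` (leaf P1-L05(a),
p200566: the abstract arrow system `Fibre D ι`, its rows `GRows`/`QRows`, its border `capV`); no cited fact, no wall binder, no `def … : Prop`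
hypothesis, no unit sequence touched (ref2 c2/c3).  NOT summit progress; discharges nothing of the K-slot `GAN24.CombesThomas.ConvCK 3 Lc`.

## Why (the (hcoer) binder of `SaddlePointBound.matrix_apriori` for road P1's strip step A5, method (M1))
In the KKT arrangement «primal `(Â, c)` ∕ dual `(μ̂, φ)`» of S1a (`ArrowSolves` = EL+M rows ∕ G+Q rows) the Hessian block is
`H = blockdiag_m 2(L_m·1 − ∂_m∂♭_mᵀ) ⊕ 0_c`, i.e. `2L_m·Π⊥_m` per alias: it is only TRANSVERSELY coercive at EVERY alias, so a coercivity bound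
`γ‖w‖² ≤ re ⟪w, H w⟫` on `ker B` must get the longitudinal polarisations and the gauge constant from the constraint rows.  This file isolates
that mechanism on the REAL ZONE (`∂♭_m = conj ∂_m`, e.g. `AliasObjects.dbAl_eq_conj` at `p = ofRealVec q`), for an ARBITRARY fibre `F : Fibre D ι`:
* §1–§2 the fine TRANSVERSE ENERGY `E(A) = Σ_m ℓ_m Σ_κ ‖t_{mκ}‖²` (`ℓ_m = Σ_κ‖∂_{mκ}‖² = L_m`, `t_m = Π⊥_m A_m`) and the identity
  **`two_mul_energy_eq_form`**: `2E(A) = Σ_m Σ_μ conj(A_{mμ})·2(L_m A_{mμ} − ∂_{mμ}(∂♭_m·A_m))` — the EL-block form IS twice the energy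
  (per block: `form_eq`, Pythagoras `sum_normSq_eq`);
* §3 ON `ker B`: the G rows give `∂♭_m·A_m = wG_m c/L_m`, hence `A_{mκ} = t_{mκ} + (wG_m c/L_m²)∂_{mκ}` (`apply_eq_trans_add_of_GRows`) and
  `Σ_κ‖A_{mκ}‖² = Σ_κ‖t_{mκ}‖² + ‖wG_m‖²‖c‖²/ℓ_m³` (`sum_normSq_eq_of_GRows`); the Q rows become EXACTLY the abstract border equation
  **`sum_wQ_trans_add_capV`**: `Σ_m wQ_{mκ} t_{mκ} + c·capV F κ = 0`, and for any distinguished alias `m₀` (the zero alias in the fibre)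
  `wQ_{m₀κ}A_{m₀κ} = −Σ_{m≠m₀} wQ_{mκ}t_{mκ} − c·Σ_{m≠m₀} wQ_{mκ}∂_{mκ}wG_m/L_m²` (`wQ_mul_apply_eq`: the bad alias, longitudinal part INCLUDED, is read
  off the other aliases — no `1/L_{m₀}`);
* §4 the weighted Cauchy–Schwarz `‖Σ_{m∈s} wQ_{mκ}t_{mκ}‖ ≤ √((Σ_{m∈s}‖wQ_{mκ}‖²/ℓ_m)·E(A))` (`norm_sum_wQ_trans_le`).
PART 2 (`GAN24/FibreKernelControlBounds`) turns these into the four kernel-control inequalities (o1)–(o4) and the assembled bound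
`Σ_m Σ_κ‖A_{mκ}‖² ≤ K·E(A)` with `K` displayed in alias-sum constants; the fibre instantiation (`AliasObjects.fibreAl`, landed scalar bounds of
`CapacitanceScalarBounds(+Border)`) is a separate module.  Unit `b2b-balaban-gan24-formalise-leaf-10` (G-an2-4 formalisation swarm), 2026-08-20.
-/

noncomputable section

open Complex Finset
open scoped BigOperators ComplexConjugate

namespace Summit.QuantumFields.BalabanUV.Beta.GAN24.FibreKernelControl

open FibreBlockSolve (dot)
open CapacitanceSolve (Fibre GRows QRows capV)

variable {D : ℕ}

/-! ## §1 One block at a real momentum: `∂♭ = conj ∂`, the transverse part, Pythagoras -/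

/-- [folklore] The real Laplacian weight of a block with forward symbol `dd`: `ℓ = Σ_κ ‖∂_κ‖²`. -/
def blkLap (dd : Fin D → ℂ) : ℝ := ∑ κ, ‖dd κ‖ ^ 2

/-- [folklore] `0 ≤ ℓ`. -/
theorem blkLap_nonneg (dd : Fin D → ℂ) : 0 ≤ blkLap dd := Finset.sum_nonneg fun _ _ => sq_nonneg _

/-- [folklore] At a real momentum (`∂♭ = conj ∂`) the pairing `∂♭·∂` is the real number `ℓ`. -/
theorem dot_conj_self (dd : Fin D → ℂ) : dot (fun κ => conj (dd κ)) dd = ((blkLap dd : ℝ) : ℂ) := by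
  unfold dot blkLap
  push_cast
  exact Finset.sum_congr rfl fun κ _ => by rw [Complex.conj_mul']

/-- [folklore] At a real momentum the pairing `∂♭·A` is the Hermitian inner product `Σ_κ conj(∂_κ) A_κ`. -/
theorem dot_conj_eq_sum (dd A : Fin D → ℂ) : dot (fun κ => conj (dd κ)) A = ∑ κ, conj (dd κ) * A κ := rfl

/-- [folklore] The TRANSVERSE PART of a block vector: `t_κ = A_κ − ∂_κ (∂♭·A)/L`. -/
def blkTrans (dd : Fin D → ℂ) (L : ℂ) (A : Fin D → ℂ) (κ : Fin D) : ℂ :=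
  A κ - dd κ * dot (fun l => conj (dd l)) A / L

/-- [folklore] Decomposition `A = t + (∂♭·A/L)·∂`. -/
theorem self_eq_blkTrans_add (dd : Fin D → ℂ) (L : ℂ) (A : Fin D → ℂ) (κ : Fin D) :
    A κ = blkTrans dd L A κ + dd κ * dot (fun l => conj (dd l)) A / L := by
  unfold blkTrans; ring

/-- [folklore] The transverse part is ORTHOGONAL to `∂`: `Σ_κ conj(∂_κ) t_κ = 0` (when `L = ℓ ≠ 0`). -/
theorem sum_conj_mul_blkTrans (dd : Fin D → ℂ) {L : ℂ} (hL : L = ((blkLap dd : ℝ) : ℂ)) (hL0 : L ≠ 0)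
    (A : Fin D → ℂ) : ∑ κ, conj (dd κ) * blkTrans dd L A κ = 0 := by
  have h1 : ∑ κ, conj (dd κ) * blkTrans dd L A κ
      = (∑ κ, conj (dd κ) * A κ) - (∑ κ, conj (dd κ) * dd κ) * dot (fun l => conj (dd l)) A / L := by
    unfold blkTrans
    rw [Finset.sum_mul, Finset.sum_div, ← Finset.sum_sub_distrib]
    exact Finset.sum_congr rfl fun κ _ => by ring
  have h2 : ∑ κ, conj (dd κ) * dd κ = L := by
    rw [hL, ← dot_conj_self]; rfl
  rw [h1, h2, ← dot_conj_eq_sum]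
  field_simp
  ring

/-- [folklore] **PYTHAGORAS ON A BLOCK** (real momentum, `L = ℓ ≠ 0`):
`Σ_κ ‖A_κ‖² = Σ_κ ‖t_κ‖² + ‖∂♭·A‖²/ℓ`. -/
theorem sum_normSq_eq (dd : Fin D → ℂ) {L : ℂ} (hL : L = ((blkLap dd : ℝ) : ℂ)) (hL0 : L ≠ 0) (A : Fin D → ℂ) :
    ∑ κ, ‖A κ‖ ^ 2 = ∑ κ, ‖blkTrans dd L A κ‖ ^ 2 + ‖dot (fun l => conj (dd l)) A‖ ^ 2 / blkLap dd := by
  set δ : ℂ := dot (fun l => conj (dd l)) A with hδ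
  have hℓ0 : blkLap dd ≠ 0 := by
    intro h; apply hL0; rw [hL, h]; simp
  -- expand `‖t + u‖²`
  have hexp : ∀ κ, ‖A κ‖ ^ 2
      = ‖blkTrans dd L A κ‖ ^ 2 + ‖dd κ * δ / L‖ ^ 2 + 2 * (blkTrans dd L A κ * conj (dd κ * δ / L)).re := by
    intro κ
    conv_lhs => rw [self_eq_blkTrans_add dd L A κ]
    rw [← Complex.normSq_eq_norm_sq, ← Complex.normSq_eq_norm_sq, ← Complex.normSq_eq_norm_sq, Complex.normSq_add]
  rw [Finset.sum_congr rfl fun κ _ => hexp κ, Finset.sum_add_distrib, Finset.sum_add_distrib]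
  -- the cross term vanishes by orthogonality
  have hcross : ∑ κ, 2 * (blkTrans dd L A κ * conj (dd κ * δ / L)).re = 0 := by
    rw [← Finset.mul_sum, ← Complex.re_sum]
    have : ∑ κ, blkTrans dd L A κ * conj (dd κ * δ / L) = conj (δ / L) * ∑ κ, conj (dd κ) * blkTrans dd L A κ := by
      rw [Finset.mul_sum]
      have hLc : conj L = L := by rw [hL, Complex.conj_ofReal]
      exact Finset.sum_congr rfl fun κ _ => by simp only [map_div₀, map_mul, hLc]; ring
    rw [this, sum_conj_mul_blkTrans dd hL hL0, mul_zero, Complex.zero_re, mul_zero]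
  -- the longitudinal term is `‖δ‖²/ℓ`
  have hlong : ∑ κ, ‖dd κ * δ / L‖ ^ 2 = ‖δ‖ ^ 2 / blkLap dd := by
    have hnL : ‖L‖ = blkLap dd := by
      rw [hL, Complex.norm_real, Real.norm_eq_abs, abs_of_nonneg (blkLap_nonneg dd)]
    simp_rw [norm_div, norm_mul, div_pow, mul_pow, hnL]
    rw [← Finset.sum_div, ← Finset.sum_mul]
    unfold blkLap
    field_simp
  rw [hcross, hlong, add_zero]

/-- [folklore] Consequently `ℓ·Σ_κ‖t_κ‖² = ℓ·Σ_κ‖A_κ‖² − ‖∂♭·A‖²` — the TRANSVERSE ENERGY of the block is the Hessian-block form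
`re Σ_μ conj(A_μ)·(L A_μ − ∂_μ(∂♭·A))` (see `re_form_eq`). -/
theorem lap_mul_sum_normSq_blkTrans (dd : Fin D → ℂ) {L : ℂ} (hL : L = ((blkLap dd : ℝ) : ℂ)) (hL0 : L ≠ 0)
    (A : Fin D → ℂ) :
    blkLap dd * ∑ κ, ‖blkTrans dd L A κ‖ ^ 2 = blkLap dd * ∑ κ, ‖A κ‖ ^ 2 - ‖dot (fun l => conj (dd l)) A‖ ^ 2 := by
  have hℓ0 : blkLap dd ≠ 0 := by
    intro h; apply hL0; rw [hL, h]; simp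
  rw [sum_normSq_eq dd hL hL0 A, mul_add, mul_div_cancel₀ _ hℓ0]
  ring

/-- [folklore] **THE HESSIAN-BLOCK FORM IS THE TRANSVERSE ENERGY** (real momentum): for the A–A block `2(L·1 − ∂∂♭ᵀ)` of the KKT fibre,
`Σ_μ conj(A_μ)·(2(L A_μ − ∂_μ(∂♭·A))) = 2(ℓ Σ‖A‖² − ‖∂♭·A‖²) = 2ℓ Σ_κ‖t_κ‖²` — a real, nonnegative number. -/
theorem form_eq (dd : Fin D → ℂ) {L : ℂ} (hL : L = ((blkLap dd : ℝ) : ℂ)) (hL0 : L ≠ 0) (A : Fin D → ℂ) :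
    ∑ μ, conj (A μ) * (2 * (L * A μ - dd μ * dot (fun l => conj (dd l)) A))
      = ((2 * (blkLap dd * ∑ κ, ‖blkTrans dd L A κ‖ ^ 2) : ℝ) : ℂ) := by
  rw [lap_mul_sum_normSq_blkTrans dd hL hL0 A]
  set δ : ℂ := dot (fun l => conj (dd l)) A with hδ
  have h1 : ∑ μ, conj (A μ) * (2 * (L * A μ - dd μ * δ)) = 2 * (L * ∑ μ, conj (A μ) * A μ - (∑ μ, conj (A μ) * dd μ) * δ) := by
    rw [Finset.mul_sum, Finset.sum_mul, ← Finset.sum_sub_distrib, Finset.mul_sum]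
    exact Finset.sum_congr rfl fun μ _ => by ring
  have h2 : ∑ μ, conj (A μ) * dd μ = conj δ := by
    rw [hδ, dot_conj_eq_sum, map_sum]
    exact Finset.sum_congr rfl fun μ _ => by rw [map_mul, Complex.conj_conj, mul_comm]
  have h3 : ∑ μ, conj (A μ) * A μ = ((∑ μ, ‖A μ‖ ^ 2 : ℝ) : ℂ) := by
    push_cast
    exact Finset.sum_congr rfl fun μ _ => by rw [Complex.conj_mul']
  rw [h1, h2, h3, Complex.conj_mul', hL]
  push_cast
  ring


/-! ## §2 Real-zone fibres of `CapacitanceSolve`: the transverse energy -/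

variable {ι : Type*}

/-- [folklore] REAL ZONE: the reflected symbol is the conjugate of the forward one (`∂♭_m = conj ∂_m`, e.g. `AliasObjects.dbAl_eq_conj` at
`p = ofRealVec q`), as a function identity. -/
theorem db_eq (F : Fibre D ι) (hre : ∀ m κ, F.db m κ = conj (F.dd m κ)) (m : ι) : F.db m = fun κ => conj (F.dd m κ) :=
  funext (hre m)

/-- [folklore] On the real zone `L_m` is the positive real number `ℓ_m = Σ_κ ‖∂_{mκ}‖²`. -/
theorem L_eq_blkLap (F : Fibre D ι) (hre : ∀ m κ, F.db m κ = conj (F.dd m κ)) (m : ι) :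
    F.L m = ((blkLap (F.dd m) : ℝ) : ℂ) := by
  rw [← F.dot_db_dd m, db_eq F hre m, dot_conj_self]

/-- [folklore] `0 < ℓ_m` (the structure field `L_ne`). -/
theorem blkLap_pos (F : Fibre D ι) (hre : ∀ m κ, F.db m κ = conj (F.dd m κ)) (m : ι) : 0 < blkLap (F.dd m) :=
  lt_of_le_of_ne (blkLap_nonneg _) fun h => F.L_ne m (by rw [L_eq_blkLap F hre m, ← h]; simp)

/-- [folklore] `‖L_m‖ = ℓ_m` on the real zone. -/
theorem norm_L (F : Fibre D ι) (hre : ∀ m κ, F.db m κ = conj (F.dd m κ)) (m : ι) : ‖F.L m‖ = blkLap (F.dd m) := by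
  rw [L_eq_blkLap F hre m, Complex.norm_real, Real.norm_eq_abs, abs_of_nonneg (blkLap_nonneg _)]

/-- [folklore] The transverse part of the alias amplitude `A_m` (abbreviation of `blkTrans` at the fibre's data). -/
def trans (F : Fibre D ι) (A : ι → Fin D → ℂ) (m : ι) (κ : Fin D) : ℂ := blkTrans (F.dd m) (F.L m) (A m) κ

/-- [folklore] THE FINE TRANSVERSE ENERGY `E(A) = Σ_m ℓ_m · Σ_κ ‖t_{mκ}‖²` — one half of the Hessian (EL-block) form of the KKT fibre on the
real zone (`two_mul_energy_eq_form`). -/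
def energy [Fintype ι] (F : Fibre D ι) (A : ι → Fin D → ℂ) : ℝ := ∑ m, blkLap (F.dd m) * ∑ κ, ‖trans F A m κ‖ ^ 2

/-- [folklore] `0 ≤ E(A)`. -/
theorem energy_nonneg [Fintype ι] (F : Fibre D ι) (A : ι → Fin D → ℂ) : 0 ≤ energy F A :=
  Finset.sum_nonneg fun _ _ => mul_nonneg (blkLap_nonneg _) (Finset.sum_nonneg fun _ _ => sq_nonneg _)

/-- [folklore] One block's weighted transverse mass in one polarisation is below the energy: `ℓ_m ‖t_{mκ}‖² ≤ E(A)` summed form —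
for every `κ` and every set of aliases `s`, `Σ_{m∈s} ℓ_m‖t_{mκ}‖² ≤ E(A)`. -/
theorem sum_lap_mul_normSq_le_energy [Fintype ι] [DecidableEq ι] (F : Fibre D ι) (A : ι → Fin D → ℂ) (s : Finset ι) (κ : Fin D) :
    ∑ m ∈ s, blkLap (F.dd m) * ‖trans F A m κ‖ ^ 2 ≤ energy F A := by
  calc ∑ m ∈ s, blkLap (F.dd m) * ‖trans F A m κ‖ ^ 2
      ≤ ∑ m, blkLap (F.dd m) * ‖trans F A m κ‖ ^ 2 :=
        Finset.sum_le_univ_sum_of_nonneg fun m => mul_nonneg (blkLap_nonneg _) (sq_nonneg _)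
    _ ≤ energy F A := Finset.sum_le_sum fun m _ =>
        mul_le_mul_of_nonneg_left (Finset.single_le_sum (fun l _ => sq_nonneg (‖trans F A m l‖)) (Finset.mem_univ κ))
          (blkLap_nonneg _)

/-- [folklore] **THE ENERGY IS HALF THE HESSIAN FORM.**  On the real zone, for ANY amplitudes `A`,
`2·E(A) = Σ_m Σ_μ conj(A_{mμ}) · 2(L_m A_{mμ} − ∂_{mμ}(∂♭_m·A_m))` — the A–A block of the EL rows of `CapacitanceSolve.ELRows` (with `μ = φ = 0`)
paired against `A`: this is the `re ⟪w, H w⟫` of `SaddlePointBound.matrix_apriori` in FINE (unweighted) coordinates. -/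
theorem two_mul_energy_eq_form [Fintype ι] (F : Fibre D ι) (hre : ∀ m κ, F.db m κ = conj (F.dd m κ)) (A : ι → Fin D → ℂ) :
    (((2 * energy F A : ℝ)) : ℂ) = ∑ m, ∑ μ, conj (A m μ) * (2 * (F.L m * A m μ - F.dd m μ * dot (F.db m) (A m))) := by
  unfold energy
  rw [Finset.mul_sum]
  push_cast
  refine Finset.sum_congr rfl fun m _ => ?_
  rw [db_eq F hre m, form_eq (F.dd m) (L_eq_blkLap F hre m) (F.L_ne m) (A m)]
  push_cast
  rfl

/-- [folklore] Energy in «mass minus longitudinal» form: `E(A) = Σ_m (ℓ_m Σ_κ‖A_{mκ}‖² − ‖∂♭_m·A_m‖²)`. -/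
theorem energy_eq [Fintype ι] (F : Fibre D ι) (hre : ∀ m κ, F.db m κ = conj (F.dd m κ)) (A : ι → Fin D → ℂ) :
    energy F A = ∑ m, (blkLap (F.dd m) * ∑ κ, ‖A m κ‖ ^ 2 - ‖dot (F.db m) (A m)‖ ^ 2) := by
  unfold energy
  refine Finset.sum_congr rfl fun m _ => ?_
  rw [db_eq F hre m]
  exact lap_mul_sum_normSq_blkTrans (F.dd m) (L_eq_blkLap F hre m) (F.L_ne m) (A m)

/-! ## §3 The kernel of the constraint rows: G rows fix the longitudinal parts, Q rows pin the gauge constant -/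

/-- [folklore] ON `ker B`, G ROWS: `∂♭_m·A_m = wG_m c / L_m` for every alias `m`. -/
theorem dot_db_eq_of_GRows (F : Fibre D ι) {A : ι → Fin D → ℂ} {c : ℂ} (hG : GRows F 0 A c) (m : ι) :
    dot (F.db m) (A m) = F.wG m * c / F.L m := by
  have h := hG m
  rw [Pi.zero_apply, sub_eq_zero] at h
  rw [← h, mul_div_cancel_left₀ _ (F.L_ne m)]

/-- [folklore] ON `ker B` the amplitude is its transverse part plus the pure-gauge part driven by the ONE constant `c`:
`A_{mκ} = t_{mκ} + (wG_m c/L_m²)·∂_{mκ}`. -/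
theorem apply_eq_trans_add_of_GRows (F : Fibre D ι) (hre : ∀ m κ, F.db m κ = conj (F.dd m κ)) {A : ι → Fin D → ℂ} {c : ℂ}
    (hG : GRows F 0 A c) (m : ι) (κ : Fin D) :
    A m κ = trans F A m κ + F.wG m * c / F.L m ^ 2 * F.dd m κ := by
  have h := self_eq_blkTrans_add (F.dd m) (F.L m) (A m) κ
  rw [← db_eq F hre m, dot_db_eq_of_GRows F hG m] at h
  rw [h]
  unfold trans
  have hL := F.L_ne m
  field_simp

/-- [folklore] ON `ker B` the longitudinal mass of block `m` is `‖∂♭_m·A_m‖²/ℓ_m = ‖wG_m‖²‖c‖²/ℓ_m³`. -/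
theorem longMass_eq_of_GRows (F : Fibre D ι) (hre : ∀ m κ, F.db m κ = conj (F.dd m κ)) {A : ι → Fin D → ℂ} {c : ℂ}
    (hG : GRows F 0 A c) (m : ι) :
    ‖dot (F.db m) (A m)‖ ^ 2 / blkLap (F.dd m) = ‖F.wG m‖ ^ 2 * ‖c‖ ^ 2 / blkLap (F.dd m) ^ 3 := by
  rw [dot_db_eq_of_GRows F hG m, norm_div, norm_mul, norm_L F hre m]
  have hℓ := (blkLap_pos F hre m).ne'
  field_simp

/-- [folklore] **PYTHAGORAS ON `ker B`**: `Σ_κ ‖A_{mκ}‖² = Σ_κ ‖t_{mκ}‖² + ‖wG_m‖²‖c‖²/ℓ_m³` for every alias `m`. -/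
theorem sum_normSq_eq_of_GRows (F : Fibre D ι) (hre : ∀ m κ, F.db m κ = conj (F.dd m κ)) {A : ι → Fin D → ℂ} {c : ℂ}
    (hG : GRows F 0 A c) (m : ι) :
    ∑ κ, ‖A m κ‖ ^ 2 = ∑ κ, ‖trans F A m κ‖ ^ 2 + ‖F.wG m‖ ^ 2 * ‖c‖ ^ 2 / blkLap (F.dd m) ^ 3 := by
  rw [← longMass_eq_of_GRows F hre hG m, db_eq F hre m]
  exact sum_normSq_eq (F.dd m) (L_eq_blkLap F hre m) (F.L_ne m) (A m)

/-- [folklore] **Q ROWS ON `ker B` = THE CAPACITANCE BORDER EQUATION.**  If moreover the homogeneous Q rows hold, then for every `κ`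
`Σ_m wQ_{mκ} t_{mκ} + c · capV_κ = 0` with EXACTLY the abstract border `CapacitanceSolve.capV F κ = Σ_m wQ_{mκ}∂_{mκ}wG_m/L_m²`. -/
theorem sum_wQ_trans_add_capV (F : Fibre D ι) [Fintype ι] (hre : ∀ m κ, F.db m κ = conj (F.dd m κ)) {A : ι → Fin D → ℂ} {c : ℂ}
    (hG : GRows F 0 A c) (hQ : QRows F 0 A) (κ : Fin D) :
    ∑ m, F.wQ m κ * trans F A m κ + c * capV F κ = 0 := by
  have h := hQ κ
  rw [Pi.zero_apply] at h
  rw [← h, CapacitanceSolve.capV, Finset.mul_sum, ← Finset.sum_add_distrib]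
  refine Finset.sum_congr rfl fun m _ => ?_
  rw [apply_eq_trans_add_of_GRows F hre hG m κ]
  ring

/-- [folklore] THE DISTINGUISHED («bad», zero) ALIAS THROUGH THE Q ROWS: for any alias `m₀`,
`wQ_{m₀κ} A_{m₀κ} = −Σ_{m≠m₀} wQ_{mκ} t_{mκ} − c·Σ_{m≠m₀} wQ_{mκ}∂_{mκ}wG_m/L_m²` — its WHOLE amplitude (longitudinal part included) is read off
the OTHER aliases; no `1/L_{m₀}` appears. -/
theorem wQ_mul_apply_eq (F : Fibre D ι) [Fintype ι] [DecidableEq ι] (hre : ∀ m κ, F.db m κ = conj (F.dd m κ))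
    {A : ι → Fin D → ℂ} {c : ℂ} (hG : GRows F 0 A c) (hQ : QRows F 0 A) (m₀ : ι) (κ : Fin D) :
    F.wQ m₀ κ * A m₀ κ = -(∑ m ∈ Finset.univ.erase m₀, F.wQ m κ * trans F A m κ)
        - c * ∑ m ∈ Finset.univ.erase m₀, F.wQ m κ * F.dd m κ * F.wG m / F.L m ^ 2 := by
  have h := hQ κ
  rw [Pi.zero_apply, ← Finset.add_sum_erase _ _ (Finset.mem_univ m₀)] at h
  have hsplit : ∑ m ∈ Finset.univ.erase m₀, F.wQ m κ * A m κ
      = (∑ m ∈ Finset.univ.erase m₀, F.wQ m κ * trans F A m κ)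
        + c * ∑ m ∈ Finset.univ.erase m₀, F.wQ m κ * F.dd m κ * F.wG m / F.L m ^ 2 := by
    rw [Finset.mul_sum, ← Finset.sum_add_distrib]
    refine Finset.sum_congr rfl fun m _ => ?_
    rw [apply_eq_trans_add_of_GRows F hre hG m κ]
    ring
  rw [hsplit] at h
  linear_combination h

/-! ## §4 Cauchy–Schwarz against the energy -/

/-- [folklore] **WEIGHTED CAUCHY–SCHWARZ**: for every alias set `s` and polarisation `κ`,
`‖Σ_{m∈s} wQ_{mκ} t_{mκ}‖ ≤ √((Σ_{m∈s} ‖wQ_{mκ}‖²/ℓ_m) · E(A))`. -/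
theorem norm_sum_wQ_trans_le [Fintype ι] [DecidableEq ι] (F : Fibre D ι) (hre : ∀ m κ, F.db m κ = conj (F.dd m κ))
    (A : ι → Fin D → ℂ) (s : Finset ι) (κ : Fin D) :
    ‖∑ m ∈ s, F.wQ m κ * trans F A m κ‖
      ≤ Real.sqrt ((∑ m ∈ s, ‖F.wQ m κ‖ ^ 2 / blkLap (F.dd m)) * energy F A) := by
  have hℓ : ∀ m, 0 < blkLap (F.dd m) := blkLap_pos F hre
  -- `‖wQ‖‖t‖ = (‖wQ‖/√ℓ)·(√ℓ‖t‖)`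
  have hfac : ∀ m, ‖F.wQ m κ‖ * ‖trans F A m κ‖
      = (‖F.wQ m κ‖ / Real.sqrt (blkLap (F.dd m))) * (Real.sqrt (blkLap (F.dd m)) * ‖trans F A m κ‖) := by
    intro m
    have hs : Real.sqrt (blkLap (F.dd m)) ≠ 0 := (Real.sqrt_pos.mpr (hℓ m)).ne'
    field_simp
  calc ‖∑ m ∈ s, F.wQ m κ * trans F A m κ‖
      ≤ ∑ m ∈ s, ‖F.wQ m κ * trans F A m κ‖ := norm_sum_le _ _
    _ = ∑ m ∈ s, (‖F.wQ m κ‖ / Real.sqrt (blkLap (F.dd m))) * (Real.sqrt (blkLap (F.dd m)) * ‖trans F A m κ‖) :=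
        Finset.sum_congr rfl fun m _ => by rw [norm_mul, hfac]
    _ ≤ Real.sqrt (∑ m ∈ s, (‖F.wQ m κ‖ / Real.sqrt (blkLap (F.dd m))) ^ 2)
          * Real.sqrt (∑ m ∈ s, (Real.sqrt (blkLap (F.dd m)) * ‖trans F A m κ‖) ^ 2) :=
        Real.sum_mul_le_sqrt_mul_sqrt _ _ _
    _ = Real.sqrt ((∑ m ∈ s, ‖F.wQ m κ‖ ^ 2 / blkLap (F.dd m)) * ∑ m ∈ s, blkLap (F.dd m) * ‖trans F A m κ‖ ^ 2) := by
        rw [← Real.sqrt_mul (Finset.sum_nonneg fun m _ => sq_nonneg _)]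
        congr 1
        congr 1
        · exact Finset.sum_congr rfl fun m _ => by rw [div_pow, Real.sq_sqrt (hℓ m).le]
        · exact Finset.sum_congr rfl fun m _ => by rw [mul_pow, Real.sq_sqrt (hℓ m).le]
    _ ≤ Real.sqrt ((∑ m ∈ s, ‖F.wQ m κ‖ ^ 2 / blkLap (F.dd m)) * energy F A) :=
        Real.sqrt_le_sqrt (mul_le_mul_of_nonneg_left (sum_lap_mul_normSq_le_energy F A s κ)
          (Finset.sum_nonneg fun m _ => div_nonneg (sq_nonneg _) (blkLap_nonneg _)))

end Summit.QuantumFields.BalabanUV.Beta.GAN24.FibreKernelControl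

end
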